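import Literature.NumberTheory.EllipticCurves.RingClassFieldRadicals
import Literature.NumberTheory.EllipticCurves.JZeroTwoTorsion
import HarnessLib

/-!
# Hu–Shu–Yin's tower `H_{9pn} = K[9pn]`, `K = ℚ(√−3)`: `∛6, ∛(2n²) ∉ K[m]` for `m` odd,
# `E_n(K[m])[2^∞] = 0` (`n` odd), and «no `Gal(K̄/K[m])`-fixed cube root of `6`» — the class-field-theory
# inputs of the `2`-adic CM-frame Kolyvagin argument on crux `UpperOffV0HSYPlus`, PROVED

Topic `NumberTheory/EllipticCurves/HuShuYin2019`, namespace
`Literature.NumberTheory.EllipticCurves.HuShuYin2019`. THEOREMS ONLY (no definition, no named fact, no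
instance, no notation; D-0014/D-0026). Cell `bsd-cm`, row `bsd-cm-k-ty1` ((M1)(K-ty) arithmetic wrapper for
VARIANT K on crux 19804 `UpperOffV0HSYPlus`), fourth seating; `--supports stmt-BirchSwinnertonDyer-19804`.
Everything is the instance `ℓ = 2`, `k = 3` of `root_intCast_not_mem_ringClassField`
(`RingClassFieldRadicals.lean`: `K[m]/K` is unramified outside `m`, Cox §9.A), stated for any imaginary
quadratic `K` with ODD discriminant (`2` unramified in `K`; `K = ℚ(√−3)` has `d_K = −3`) and any ODD `m`
(Hu–Shu–Yin's `H_{9p} = K[9p]`, the tower `H_{9pn} = K[9pn]` with `p`, `n` odd).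

WHAT IS PROVED (sorry-free):

* §1 `pow_three_ne_of_mem_ringClassField` (`z³ ≠ 2ᵃ·d'` for `z ∈ K[m]`, `3 ∤ a`, `d'` odd),
  **`pow_three_ne_six_of_mem_ringClassField`** (`∛6 ∉ K[m]`), `pow_three_ne_two_mul_sq_of_mem_ringClassField`
  (`∛(2n²) ∉ K[m]` for `n` odd; `n = 9, p, 3p²` give the `2`-division fields `K(∛6)`, `K(∛(4p))`,
  `K(∛(18p))` of `E_9`, `E_p`, `E_{3p²}`); over `K` itself (`m = 1`, `ι(K) ⊆ K[1]`):
  `pow_three_ne_two_mul_sq` (`2n²` is not a cube in `K`) and **`forall_pow_three_add_a₆_ne_zero`**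
  (`∀ t : K, t³ + a₆(E_n) ≠ 0`, `a₆(E_n) = −432n²` — the displayed hypothesis `hb` of
  `SylvesterTwoCoupledDescentF4Galois.exists_absGal_smul_eq_of_no_cubeRoot` for `E_9, E_p, E_{3p²}`).
* §2 `cubeSumCurve_eq_zero_of_two_pow_smul_eq_zero` (`E_n(F)[2^∞] = 0` when `2n²` is not a cube in `F` —
  the tree's `cubeSumCurve_eq_zero_of_two_smul_eq_zero`, a `2`-torsion point of `y² = x³ − 432n²` being
  `(6∛(2n²), 0)`, iterated, with the `DecidableEq F` of the group law a PARAMETER so that it applies to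
  subfields of `ℂ`), and **`cubeSumCurve_ringClassField_eq_zero_of_two_pow_smul_eq_zero`**:
  `E_n(K[m])[2^∞] = 0` for the cube-sum curve `E_n` (`cubeSumCurve n`), `n` odd — the «NO `2`-TORSION OVER
  THE TOWER» input of the `2`-adic Kolyvagin argument for the pair `(B, A) = (E_p, E_{3p²})` and `E_9`
  (Gross 1991, §4: *"`E(K_n)` has no `p`-torsion"*, the hypothesis of his Lemma 4.3 / (4.2)–(4.4), here at
  `p = 2` and WITHOUT an image hypothesis; the algebraic half is g1's `JZeroTwoTorsion.lean`), instances
  `_nine`, `_of_odd` (`E_p`), `_three_mul_sq` (`E_{3p²}`).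
* §3 (the `K̄`-form consumed by `HuShuYin2019.exists_cmFrame_kolyvaginClass`,
  `isAdmissible_map_fixedPoints_cubeSumCurve_nine`, `isAdmissible_cubeSumCurve_nine_of_forall` — their
  hypothesis `h6`) `pow_three_ne_of_forall_apply_eq` and **`pow_three_ne_six_of_forall_apply_eq`**: for `m`
  odd, an embedding `emb : K[m] → K̄` over `K` and ANY subgroup `N ≤ Γ_K` with `g ∈ N ↔ g ∘ emb = emb`
  (the convention of `GeomPointsEmbeddingDescent.lean`),
  `∀ z : K̄, (∀ h ∈ N, h z = z) → z³ ≠ 6` — VERBATIM the displayed `h6` of the rows k-p1/k-p2 of crux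
  19804 at `N = Gal(K̄/H_{9pn})` (scalar Galois descent `exists_eq_emb_of_forall_apply_eq` + §1).

HONEST FRAMING: classical class field theory + the `2`-torsion of `y² = x³ + b`; nothing about
`L`-functions, Selmer groups, `Ш` or BSD is asserted; no summit statement is touched.

## References

* Y. Hu, J. Shu, H. Yin, *An explicit Gross–Zagier formula related to the Sylvester conjecture*,
  Trans. AMS 372 (2019); arXiv:1708.05266, §2 (the curves `E_n : x³ + y³ = n`, i.e. `y² = x³ − 432n²`;
  the fields `H_{3p}`, `H_{9p} = H_{3p}(∛3)`, `L_{(3,p)} = K(∛3, ∛p) ⊂ H_{9p}`). [HuShuYin2019]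
* B. H. Gross, *Kolyvagin's work on modular elliptic curves*, LMS LN 153 (1991), §4, Lemma 4.3 and
  (4.2)–(4.4) ("`E(K_n)` has no `p`-torsion"). [GrossLMS1991]
* D. A. Cox, *Primes of the form x² + ny²*, 2nd ed. (2013), §9.A (p. 180). [Cox2013]
* J. H. Silverman, J. Tate, *Rational Points on Elliptic Curves*, 2nd ed. (2015), Thm. 2.1(a).
  [SilvermanTate2015]

## Mathlib / tree search
Tree: `root_intCast_not_mem_ringClassField`, `exists_eq_emb_of_forall_apply_eq` (`RingClassFieldRadicals`),
`HuShuYin2019.cubeSumCurve_eq_zero_of_two_smul_eq_zero` (`JZeroTwoTorsion`), `HuShuYin2019.cubeSumCurve`;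
consumers `HuShuYin2019.exists_cmFrame_kolyvaginClass` / `isAdmissible_cubeSumCurve_nine_of_forall`
(`CubicTwistKolyvaginClassesJZero`, `JZeroFixedPointsAdmissible`). `lean search 'pow_three_ne_six'` → nothing.
presearch: «no 2-torsion of x³ + y³ = n over ring class fields of ℚ(√−3) of odd conductor» → memo-level
(cell) statement; published ingredients [corpus:book:cox2013-primes-form-i-x-sup-2-sup p0193] (Cox §9.A)
and [corpus:paper:arxiv-1708.05266 p. 4–8] (HSY §2, the curves and fields).
-/

noncomputable section

open NumberField

namespace Literature.NumberTheory.EllipticCurves.HuShuYin2019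

open Literature.NumberTheory.EllipticCurves WeierstrassCurve

variable {K : Type} [Field K] [NumberField K]

/-! ### §1–§2. `∛6, ∛(2n²) ∉ K[m]` (`m` odd, `d_K` odd) and `E_n(K[m])[2^∞] = 0` -/


/-- **No cube root of `2ᵃ·d'` (`3 ∤ a`, `d'` odd) in `K[m]`** for `K` imaginary quadratic with ODD
discriminant (so `2 ∤ d_K`: `2` is unramified in `K` — e.g. `K = ℚ(√−3)`, `d_K = −3`, where `2` is inert)
and `m` ODD: `root_intCast_not_mem_ringClassField` at `ℓ = 2`, `k = 3`. (Hu–Shu–Yin's `H_{9p}`,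
`H_{9pn}` are `K[9p]`, `K[9pn]` with `9pn` odd.) [cite: Cox2013, §9.A (p. 180)] [cite: HuShuYin2019, §2] -/
theorem pow_three_ne_of_mem_ringClassField (hK : IsImaginaryQuadratic K) (ι : K →+* ℂ)
    (hdK : Odd (NumberField.discr K)) {m : ℕ} (hm : Odd m) {a : ℕ} (ha : ¬ 3 ∣ a) {d' : ℤ}
    (hd' : Odd d') {z : ℂ} (hz : z ∈ ringClassField K ι m) :
    z ^ 3 ≠ (2 : ℂ) ^ a * (d' : ℂ) := by
  intro h
  have hm0 : m ≠ 0 := by rintro rfl; exact Nat.not_odd_zero hm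
  have h2m : ¬ 2 ∣ m := hm.not_two_dvd_nat
  have h2D : ¬ ((2 : ℕ) : ℤ) ∣ NumberField.discr K := by
    rw [Nat.cast_ofNat]; exact fun h ↦ (Int.not_even_iff_odd.mpr hdK) (even_iff_two_dvd.mpr h)
  have h2d' : ¬ ((2 : ℕ) : ℤ) ∣ d' := by
    rw [Nat.cast_ofNat]; exact fun h ↦ (Int.not_even_iff_odd.mpr hd') (even_iff_two_dvd.mpr h)
  exact root_intCast_not_mem_ringClassField hK ι hm0 Nat.prime_two h2m h2D ha h2d' z
    (by rw [h]; push_cast; ring) hz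

/-- **`∛6 ∉ K[m]`** (`d_K` odd, `m` odd): no `z ∈ K[m]` with `z³ = 6` — the field `K(E_9[2]) = K(∛6)`
of the `2`-torsion of `E_9 : y² = x³ − 432·81` (`432·81 = 18³·6`) meets `K[m]` in `K`. This is the
class-field-theory input `h6` of the CM-frame Kolyvagin classes (`JZeroFixedPointsAdmissible`,
`CubicTwistKolyvaginClassesJZero`). [cite: Cox2013, §9.A (p. 180)] [cite: HuShuYin2019, §2] -/
theorem pow_three_ne_six_of_mem_ringClassField (hK : IsImaginaryQuadratic K) (ι : K →+* ℂ)
    (hdK : Odd (NumberField.discr K)) {m : ℕ} (hm : Odd m) {z : ℂ}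
    (hz : z ∈ ringClassField K ι m) : z ^ 3 ≠ 6 := by
  have h := pow_three_ne_of_mem_ringClassField hK ι hdK hm (a := 1) (by norm_num) (d' := 3)
    (by decide) hz
  norm_num at h
  exact h

/-- **`∛(2n²) ∉ K[m]`** for `n` odd (`d_K` odd, `m` odd): no `z ∈ K[m]` with `z³ = 2n²`. For
`n = 9, p, 3p²` (`p` odd) these are the `2`-torsion fields `K(∛6) = K(∛162)`, `K(∛(2p²)) = K(∛(4p))`,
`K(∛(18p⁴)) = K(∛(18p))` of `E_9`, `E_p`, `E_{3p²}`. [cite: Cox2013, §9.A (p. 180)] [cite: HuShuYin2019, §2] -/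
theorem pow_three_ne_two_mul_sq_of_mem_ringClassField (hK : IsImaginaryQuadratic K) (ι : K →+* ℂ)
    (hdK : Odd (NumberField.discr K)) {m : ℕ} (hm : Odd m) {n : ℤ} (hn : Odd n) {z : ℂ}
    (hz : z ∈ ringClassField K ι m) : z ^ 3 ≠ 2 * (n : ℂ) ^ 2 := by
  have h := pow_three_ne_of_mem_ringClassField hK ι hdK hm (a := 1) (by norm_num) (d' := n ^ 2)
    (hn.pow) hz
  push_cast at h
  rwa [pow_one] at h

/-- **`2n²` is not a cube in `K` itself** (`K` imaginary quadratic with odd discriminant, `n` odd): the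
case `m = 1` read back along an embedding `ι : K → K[1] ⊂ ℂ` (`ι(K) ⊆ K[1]`). For `K = ℚ(ω)` and
`n = 9, p, 3p²`: `∛162 = 3∛6`, `∛(2p²)`, `∛(18p⁴)` are not in `K`. [cite: Cox2013, §9.A (p. 180)]
[cite: HuShuYin2019, §2] -/
theorem pow_three_ne_two_mul_sq (hK : IsImaginaryQuadratic K) (hdK : Odd (NumberField.discr K))
    {n : ℤ} (hn : Odd n) (t : K) : t ^ 3 ≠ 2 * (n : K) ^ 2 := by
  obtain ⟨ι⟩ := (inferInstance : Nonempty (K →+* ℂ))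
  intro ht
  apply pow_three_ne_two_mul_sq_of_mem_ringClassField hK ι hdK odd_one hn
    (apply_mem_ringClassField ι 1 t)
  rw [← map_pow, ht, map_mul, map_pow, map_intCast, map_ofNat]

/-- **«`X³ + a₆` has no root in `K`» for the cube-sum curves**: for `K` imaginary quadratic with odd
discriminant and `n` an odd integer, `t³ + a₆(E_n) ≠ 0` for every `t ∈ K`, where
`E_n = (cubeSumCurve n).baseChange K`, `a₆(E_n) = −432n² = −6³·(2n²)`. At `K = ℚ(ω)` and
`n ∈ {9, p, 3p²}` (`p` odd) this is the displayed hypothesis `hb : ∀ t : K, t ^ 3 + V.a₆ ≠ 0` of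
`SylvesterTwoCoupledDescentF4Galois.exists_absGal_smul_eq_of_no_cubeRoot` (p629275) for `E_9`, `B = E_p`,
`A = E_{3p²}` — cite, do not display. [cite: HuShuYin2019, §2] [cite: Cox2013, §9.A (p. 180)] -/
theorem forall_pow_three_add_a₆_ne_zero (hK : IsImaginaryQuadratic K) (hdK : Odd (NumberField.discr K))
    {n : ℚ} (hn : ∃ n₀ : ℤ, Odd n₀ ∧ (n₀ : ℚ) = n) (t : K) :
    t ^ 3 + ((cubeSumCurve n).baseChange K).a₆ ≠ 0 := by
  obtain ⟨n₀, hn₀, rfl⟩ := hn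
  have ha : ((cubeSumCurve (n₀ : ℚ)).baseChange K).a₆ = algebraMap ℚ K (-432 * (n₀ : ℚ) ^ 2) := rfl
  rw [ha, map_mul, map_neg, map_pow, eq_ratCast, eq_ratCast, Rat.cast_intCast, Rat.cast_ofNat]
  intro ht
  apply pow_three_ne_two_mul_sq hK hdK hn₀ (t / 6)
  field_simp
  linear_combination ht

/-- **`E_n(F)[2^∞] = 0` when `2n²` is not a cube in `F`** — the tree's
`cubeSumCurve_eq_zero_of_two_smul_eq_zero` (`E_n(F)[2] = 0`: a point of order `2` on
`y² = x³ − 432n²` is `(6∛(2n²), 0)`) iterated to `2`-power torsion, and stated INSTANCE-POLYMORPHICALLY: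
the `DecidableEq F` feeding the group law on `E(F)` is a parameter (the tree lemma bakes in the classical
instance, which is not the one inferred for subfields of `ℂ` such as `K[m]`; the two group structures agree
because `DecidableEq F` is a subsingleton). [cite: SilvermanTate2015, Thm. 2.1(a)] [cite: HuShuYin2019, §2] -/
theorem cubeSumCurve_eq_zero_of_two_pow_smul_eq_zero {F : Type*} [Field F] [inst : DecidableEq F]
    [CharZero F] (n : ℚ) (hF : ∀ t : F, t ^ 3 ≠ 2 * (n : F) ^ 2) (k : ℕ)
    (P : ((cubeSumCurve n).baseChange F).toAffine.Point) (hP : 2 ^ k • P = 0) : P = 0 := by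
  have hinst : inst = fun a b ↦ Classical.propDecidable (a = b) := Subsingleton.elim _ _
  subst hinst
  letI : DecidableEq F := fun a b ↦ Classical.propDecidable (a = b)
  induction k generalizing P with
  | zero => simpa using hP
  | succ k ih =>
    rw [pow_succ', mul_nsmul'] at hP
    exact ih P (cubeSumCurve_eq_zero_of_two_smul_eq_zero n hF (2 ^ k • P) hP)

/-- **`E_n(K[m])[2^∞] = 0`** — NO `2`-POWER TORSION OVER THE TOWER: for `K` imaginary quadratic with odd
discriminant, `m` odd, and the cube-sum curve `E_n : y² = x³ − 432 n²` (`cubeSumCurve n`) with `n` an ODD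
integer, every `K[m]`-rational point `P` with `2^k • P = O` is `O`. (A point of order `2` is
`(6·∛(2n²), 0)` — the tree's `cubeSumCurve_eq_zero_of_two_smul_eq_zero` — and `∛(2n²) ∉ K[m]`.) For
`K = ℚ(√−3)`, `m = 9pn'`, `n ∈ {9, p, 3p²}` this is memo-two §57.3 «`E_9[2](H_{9pn}) = B[2](H_{9pn}) =
A[2](H_{9pn}) = 0`», the hypothesis "`E(K_n)` has no `p`-torsion" of Gross's §4 at `p = 2`.
[cite: GrossLMS1991, §4 Lemma 4.3 and (4.2)–(4.4)] [cite: HuShuYin2019, §2] [cite: SilvermanTate2015, Thm. 2.1(a)] -/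
theorem cubeSumCurve_ringClassField_eq_zero_of_two_pow_smul_eq_zero (hK : IsImaginaryQuadratic K)
    (ι : K →+* ℂ) (hdK : Odd (NumberField.discr K)) {m : ℕ} (hm : Odd m) {n : ℚ}
    (hn : ∃ n₀ : ℤ, Odd n₀ ∧ (n₀ : ℚ) = n) (k : ℕ)
    (P : ((cubeSumCurve n).baseChange (ringClassField K ι m)).toAffine.Point) (hP : 2 ^ k • P = 0) :
    P = 0 := by
  obtain ⟨n₀, hn₀, rfl⟩ := hn
  have hF : ∀ t : ringClassField K ι m, t ^ 3 ≠ 2 * ((n₀ : ℚ) : ringClassField K ι m) ^ 2 := by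
    intro t ht
    apply pow_three_ne_two_mul_sq_of_mem_ringClassField hK ι hdK hm hn₀ t.2
    have := congrArg (fun x : ringClassField K ι m ↦ (x : ℂ)) ht
    simp only [SubmonoidClass.coe_pow] at this
    rw [this]
    push_cast
    rfl
  exact cubeSumCurve_eq_zero_of_two_pow_smul_eq_zero (n₀ : ℚ) hF k P hP

/-- `E_9(K[m])[2^∞] = 0` (`m` odd, `d_K` odd). [cite: HuShuYin2019, §2] [cite: GrossLMS1991, §4 Lemma 4.3] -/
theorem cubeSumCurve_nine_ringClassField_eq_zero_of_two_pow_smul_eq_zero (hK : IsImaginaryQuadratic K)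
    (ι : K →+* ℂ) (hdK : Odd (NumberField.discr K)) {m : ℕ} (hm : Odd m) (k : ℕ)
    (P : ((cubeSumCurve 9).baseChange (ringClassField K ι m)).toAffine.Point) (hP : 2 ^ k • P = 0) :
    P = 0 :=
  cubeSumCurve_ringClassField_eq_zero_of_two_pow_smul_eq_zero hK ι hdK hm ⟨9, by decide, by norm_num⟩
    k P hP

/-- `E_p(K[m])[2^∞] = 0` for `p` odd (`m` odd, `d_K` odd) — `B = E_p`. [cite: HuShuYin2019, §2]
[cite: GrossLMS1991, §4 Lemma 4.3] -/
theorem cubeSumCurve_ringClassField_eq_zero_of_two_pow_smul_eq_zero_of_odd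
    (hK : IsImaginaryQuadratic K) (ι : K →+* ℂ) (hdK : Odd (NumberField.discr K)) {m : ℕ} (hm : Odd m)
    {p : ℕ} (hp : Odd p) (k : ℕ)
    (P : ((cubeSumCurve (p : ℚ)).baseChange (ringClassField K ι m)).toAffine.Point)
    (hP : 2 ^ k • P = 0) : P = 0 :=
  cubeSumCurve_ringClassField_eq_zero_of_two_pow_smul_eq_zero hK ι hdK hm
    ⟨p, by exact_mod_cast hp, by push_cast; rfl⟩ k P hP

/-- `E_{3p²}(K[m])[2^∞] = 0` for `p` odd (`m` odd, `d_K` odd) — `A = E_{3p²}`. [cite: HuShuYin2019, §2]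
[cite: GrossLMS1991, §4 Lemma 4.3] -/
theorem cubeSumCurve_three_mul_sq_ringClassField_eq_zero_of_two_pow_smul_eq_zero
    (hK : IsImaginaryQuadratic K) (ι : K →+* ℂ) (hdK : Odd (NumberField.discr K)) {m : ℕ} (hm : Odd m)
    {p : ℕ} (hp : Odd p) (k : ℕ)
    (P : ((cubeSumCurve (3 * (p : ℚ) ^ 2)).baseChange (ringClassField K ι m)).toAffine.Point)
    (hP : 2 ^ k • P = 0) : P = 0 :=
  cubeSumCurve_ringClassField_eq_zero_of_two_pow_smul_eq_zero hK ι hdK hm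
    ⟨3 * (p : ℤ) ^ 2, (by decide : Odd (3 : ℤ)).mul (by exact_mod_cast hp.pow), by push_cast; rfl⟩
    k P hP

/-! ### §3. The `K̄`-form: no `Gal(K̄/K[m])`-fixed cube root of `6` (the rows' `h6`) -/


/-- **No `N`-fixed cube root of `2ᵃ·d'`** (`3 ∤ a`, `d'` odd) for `N = Gal(K̄/emb K[m])`, `m` odd,
`d_K` odd: the `K̄`-form of `pow_three_ne_of_mem_ringClassField` along an embedding
`emb : K[m] → K̄` over `K`, for ANY subgroup `N ≤ Γ_K` with `g ∈ N ↔ g ∘ emb = emb` (the convention of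
`GeomPointsEmbeddingDescent.lean`: `exists_subgroup_mem_iff` / Mathlib's `fixingSubgroup`).
[cite: Cox2013, §9.A (p. 180)] [cite: HuShuYin2019, §2] -/
theorem pow_three_ne_of_forall_apply_eq (hK : IsImaginaryQuadratic K) (ι : K →+* ℂ)
    (hdK : Odd (NumberField.discr K)) {m : ℕ} (hm : Odd m)
    (emb : ringClassField K ι m →+* AlgebraicClosure K)
    (hemb : ∀ k : K, emb (algebraMap K (ringClassField K ι m) k) = algebraMap K (AlgebraicClosure K) k)
    (N : Subgroup (Field.absoluteGaloisGroup K))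
    (hN : ∀ g : Field.absoluteGaloisGroup K, g ∈ N ↔
      ∀ x : ringClassField K ι m, (show AlgebraicClosure K ≃ₐ[K] AlgebraicClosure K from g) (emb x) = emb x)
    {a : ℕ} (ha : ¬ 3 ∣ a) {d' : ℤ} (hd' : Odd d') (z : AlgebraicClosure K)
    (hz : ∀ h ∈ N, (show AlgebraicClosure K ≃ₐ[K] AlgebraicClosure K from h) z = z) :
    z ^ 3 ≠ (2 : AlgebraicClosure K) ^ a * (d' : AlgebraicClosure K) := by
  intro h3
  obtain ⟨x, rfl⟩ := exists_eq_emb_of_forall_apply_eq emb hemb z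
    (fun g hg ↦ hz g ((hN g).mpr hg))
  -- `x³ = 2ᵃ d'` in `K[m] ⊂ ℂ`
  have hx : x ^ 3 = ((((2 : ℤ) ^ a * d' : ℤ)) : ringClassField K ι m) := by
    apply emb.injective
    rw [map_pow, h3, map_intCast]
    push_cast
    ring
  apply pow_three_ne_of_mem_ringClassField hK ι hdK hm ha hd' x.2
  have := congrArg (fun y : ringClassField K ι m ↦ (y : ℂ)) hx
  simp only [SubmonoidClass.coe_pow, SubringClass.coe_intCast] at this
  rw [this]
  push_cast
  ring

/-- **THE ROWS' `h6` — no `Gal(K̄/H_{9pn})`-fixed cube root of `6`.** For `K` imaginary quadratic with odd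
discriminant (`K = ℚ(√−3)`), `m` odd (`m = 9pn`), an embedding `emb : K[m] → K̄` over `K` and ANY
subgroup `N ≤ Γ_K` with `g ∈ N ↔ g ∘ emb = emb`:
  `∀ z : K̄, (∀ h ∈ N, h z = z) → z³ ≠ 6`
— VERBATIM the hypothesis `h6` of `HuShuYin2019.isAdmissible_cubeSumCurve_nine_of_forall`,
`isAdmissible_map_fixedPoints_cubeSumCurve_nine` and `exists_cmFrame_kolyvaginClass` (admissibility of
`E_9(K̄)^N = E_9(H_{9pn})` at every `2`-power level, Gross's Lemma 4.3 at `p = 2`), now a theorem of class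
field theory: `K(∛6)/K` is ramified at the prime above `2`, `K[m]/K` is not.
[cite: Cox2013, §9.A (p. 180)] [cite: GrossLMS1991, §4 Lemma 4.3] [cite: HuShuYin2019, §2] -/
theorem pow_three_ne_six_of_forall_apply_eq (hK : IsImaginaryQuadratic K) (ι : K →+* ℂ)
    (hdK : Odd (NumberField.discr K)) {m : ℕ} (hm : Odd m)
    (emb : ringClassField K ι m →+* AlgebraicClosure K)
    (hemb : ∀ k : K, emb (algebraMap K (ringClassField K ι m) k) = algebraMap K (AlgebraicClosure K) k)
    (N : Subgroup (Field.absoluteGaloisGroup K))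
    (hN : ∀ g : Field.absoluteGaloisGroup K, g ∈ N ↔
      ∀ x : ringClassField K ι m, (show AlgebraicClosure K ≃ₐ[K] AlgebraicClosure K from g) (emb x) = emb x) :
    ∀ z : AlgebraicClosure K,
      (∀ h ∈ N, (show AlgebraicClosure K ≃ₐ[K] AlgebraicClosure K from h) z = z) → z ^ 3 ≠ 6 := by
  intro z hz
  have h := pow_three_ne_of_forall_apply_eq hK ι hdK hm emb hemb N hN (a := 1) (by norm_num) (d' := 3)
    (by decide) z hz
  norm_num at h
  exact h

end Literature.NumberTheory.EllipticCurves.HuShuYin2019
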